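import Summits.QuantumFields.YangMills.Theses.LangevinControlUV
import Summits.QuantumFields.YangMills.Theorems.LangevinControlUVLatticeGapInUVUnitsGapToClustering
import Summits.QuantumFields.YangMills.Theorems.LangevinControlUVLatticeGapInUVUnitsSpectralToolkit
import Summits.QuantumFields.YangMills.Theorems.LangevinControlUVLatticeGapInUVUnitsLightCone
import Literature.MathematicalPhysics.QuantumLattice.WilsonBlockHeatBath

/-!
# Crux `LatticeGapInUVUnitsC` (stmt-QuantumFields-16206), line `Sketch` (amplitude-exhaustion-ratchet): the checked reduction

Support file for item stmt-QuantumFields-16206 (route `LangevinControlUV` of `YangMills`), line lead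
prover-line-stmt-QuantumFields-16206-0, 2026-08-16.  The two provable stubs of the line are LANDED —
S1 `stub_ratioSeed` (p122959: the reflection-positive axis ratio `v(β,k) = Cov_{16k}(P_0,P_{2k e₂})/Cov_{16k}(P_0,P_{k e₂})`
is `≥ vmin > 0` on the top femto octave, from the package's TWO-sidedness and interval pinning for continuous rulers) and
S2 `stub_ratioBound` (p122942: `v ≤ 1` on every torus `16k`, every `β ≥ 0`, reflection positivity) — and the knabe
line's certificate pipeline `stub_gapToClustering` (p90222) / `stub_spectralToolkit` (p90500) / `stub_lightCone`
(p80165) is landed too; the line's composition is the following kernel-checked chain, stated with every hypothesis WRITTEN OUT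
in the route's vocabulary (no definition is introduced, no unbuilt module is imported: SEED and BOUND enter as hypotheses and are
instantiated by the tree theorems in the skeleton `Cruxes/LatticeGapInUVUnitsC/Lines/Sketch.lean`):

* `exhaustion` — a real sequence seeded at `umin`, bounded by `U`, which per step grows by `1+δ` or triggers `P`,
  triggers `P` within `J` steps once `(1+δ)^J umin > U` (`exists_window_count`);
* `concl_of_ratchet` — generic: seed ∧ bound ∧ windowed dichotomy ∧ certificate pipeline ⇒ the crux's conclusion with
  rate `c/(2^{MJ} ℓ)`, `J` INDEPENDENT of `β` (the confinement scale `2^{MJ}` is OUTPUT of the bookkeeping);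
* `latticeGapInUVUnitsC_of_ratchet` — **the crux BY NAME from the line's three stubs** (SEED and BOUND landed, DICHOTOMY open:
  windowed grow-or-certify for the ratio `v`, certificate = global Poincaré inequality of the overlapping block heat
  bath at SOME cell `≤` the side of the torus on which the ratio stalled);
* `ratioDichotomy_of_globalCertificate` — the open stub follows from ONE `β`-uniform global block-sampler certificate at
  a physical cell `K₀` (the knabe line's promoted `stub_blockSamplerCertificate` in global form): the ratchet's stub is
  at most as strong as the knabe line's, the growth branch is added freedom; hence also
  `latticeGapInUVUnitsC_of_globalCertificate`.
-/

open scoped BigOperators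
open MeasureTheory Filter Topology
open Literature.MathematicalPhysics.QuantumFieldTheory Literature.MathematicalPhysics.QuantumLattice
open Literature.MathematicalPhysics.QuantumLattice.WilsonBlockHeatBath
open Summit.QuantumFields.YangMills.Theses.LangevinControlUV

noncomputable section

namespace Summit.QuantumFields.YangMills.Theorems.LatticeGapInUVUnitsC.AmplitudeRatchet

/-! ## §1 Exhaustion of a bounded quantity under a grow-or-certify dichotomy -/

/-- **Exhaustion lemma.** A real sequence seeded at `u 0 ≥ umin`, bounded by `U` up to index `J`, which at every
step `j < J` either grows by the factor `1 + δ` or triggers `P (j+1)`, triggers `P` at some index `1 ≤ j ≤ J` as soon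
as `(1+δ)^J · umin > U`. -/
theorem exhaustion {u : ℕ → ℝ} {P : ℕ → Prop} {umin U δ : ℝ} {J : ℕ} (hδ : 0 ≤ δ)
    (h0 : umin ≤ u 0) (hbound : ∀ j, j ≤ J → u j ≤ U)
    (hdich : ∀ j, j < J → (1 + δ) * u j ≤ u (j + 1) ∨ P (j + 1))
    (hJ : U < (1 + δ) ^ J * umin) :
    ∃ j, 1 ≤ j ∧ j ≤ J ∧ P j := by
  by_contra hno
  push Not at hno
  have hgrow : ∀ j, j ≤ J → (1 + δ) ^ j * umin ≤ u j := by
    intro j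
    induction j with
    | zero => intro _; simpa using h0
    | succ k ih =>
      intro hk
      have hk' : k < J := Nat.lt_of_succ_le hk
      rcases hdich k hk' with hle | hP
      · calc (1 + δ) ^ (k + 1) * umin = (1 + δ) * ((1 + δ) ^ k * umin) := by ring
          _ ≤ (1 + δ) * u k := mul_le_mul_of_nonneg_left (ih hk'.le) (by linarith)
          _ ≤ u (k + 1) := hle
      · exact absurd hP (hno (k + 1) (Nat.succ_le_succ (Nat.zero_le k)) hk)
  have h1 := hgrow J le_rfl
  have h2 := hbound J le_rfl
  linarith

/-- A window count `J` with `(1+δ)^J · umin > U` exists for every `umin > 0`, `δ > 0`. -/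
theorem exists_window_count {umin δ : ℝ} (U : ℝ) (hmin : 0 < umin) (hδ : 0 < δ) :
    ∃ J : ℕ, U < (1 + δ) ^ J * umin := by
  obtain ⟨J, hJ⟩ := pow_unbounded_of_one_lt (U / umin) (by linarith : (1 : ℝ) < 1 + δ)
  exact ⟨J, by rwa [div_lt_iff₀ hmin] at hJ⟩

/-- **Registered sub-goal `stub_exhaustion`** (`--supports stmt-QuantumFields-16206`): the exhaustion lemma of the line's
skeleton in closed form — a quantity seeded at `umin`, bounded by `U` up to `J`, growing by `1+δ` per step unless `P` fires,
fires `P` at some `1 ≤ j ≤ J` once `(1+δ)^J umin > U` (the confinement scale is OUTPUT of this bookkeeping). -/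
theorem stub_exhaustion : ∀ (u : ℕ → ℝ) (P : ℕ → Prop) (umin U δ : ℝ) (J : ℕ), 0 ≤ δ → umin ≤ u 0 → (∀ j : ℕ, j ≤ J → u j ≤ U) → (∀ j : ℕ, j < J → (1 + δ) * u j ≤ u (j + 1) ∨ P (j + 1)) → U < (1 + δ) ^ J * umin → ∃ j : ℕ, 1 ≤ j ∧ j ≤ J ∧ P j :=
  fun _u _P _umin _U _δ _J hδ h0 hbound hdich hJ => exhaustion hδ h0 hbound hdich hJ

/-! ## §2 The generic ratchet reduction -/

section Generic

variable {G : Type} [Group G] [TopologicalSpace G] [IsTopologicalGroup G] [CompactSpace G]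
  [MeasurableSpace G] [BorelSpace G]

/-- **`Concl` from an amplitude ratchet** (generic in the amplitude `amp β N` and the certificate `Cert β b`).
For `β ≥ β₂`: a scale `N₀ β ≥ 1` with `N₀ β · a β ≤ ℓ`; SEED `amp β (N₀ β) ≥ umin`; BOUND `amp β (2^{Mj} N₀ β) ≤ U`
(`j ≤ J`); DICHOTOMY (`j < J`): growth by `1+δ` over the window or `Cert` at the new scale; PIPELINE: `Cert β b` clusters
every species pair at rate `c/b` on tori `S ≥ K b` with pair-dependent constants; COUNT `(1+δ)^J umin > U`.  Then the
crux's conclusion holds with `c₁ = c/(2^{MJ} ℓ)` and `S₁ β = ⌈K⌉ 2^{MJ} N₀ β`. -/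
theorem concl_of_ratchet (r : LatticeRep G) {a : ℝ → ℝ} (hpos : ∀ β, 0 < a β)
    (amp : ℝ → ℕ → ℝ) (Cert : ℝ → ℕ → Prop)
    {ℓ β₂ umin U δ c K : ℝ} (hδ : 0 ≤ δ) (hc : 0 < c) (hℓ : 0 < ℓ)
    (N₀ : ℝ → ℕ) (hN₀pos : ∀ β, β₂ ≤ β → 1 ≤ N₀ β) (hN₀ : ∀ β, β₂ ≤ β → (N₀ β : ℝ) * a β ≤ ℓ)
    (M J : ℕ) (hJ : U < (1 + δ) ^ J * umin)
    (hseed : ∀ β, β₂ ≤ β → umin ≤ amp β (N₀ β))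
    (hbound : ∀ β, β₂ ≤ β → ∀ j : ℕ, j ≤ J → amp β (2 ^ (M * j) * N₀ β) ≤ U)
    (hdich : ∀ β, β₂ ≤ β → ∀ j : ℕ, j < J →
      (1 + δ) * amp β (2 ^ (M * j) * N₀ β) ≤ amp β (2 ^ (M * (j + 1)) * N₀ β) ∨
        Cert β (2 ^ (M * (j + 1)) * N₀ β))
    (hcert : ∀ A B : YMSpecies G, ∃ C : ℝ, ∀ β : ℝ, β₂ ≤ β → ∀ b : ℕ, 1 ≤ b → Cert β b →
      ∀ S n : ℕ, K * b ≤ S → n ≤ S →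
        |latticeConnectedCorr r.ρ β (2 * S + 1) A.F B.F n| ≤ C * Real.exp (-(c * n / b))) :
    ∃ (c₁ β₂' : ℝ) (S₁ : ℝ → ℕ), 0 < c₁ ∧ ∀ A B : YMSpecies G, ∃ C : ℝ, ∀ β : ℝ, β₂' ≤ β → ∀ S n : ℕ,
      S₁ β ≤ S → n ≤ S →
        |latticeConnectedCorr r.ρ β (2 * S + 1) A.F B.F n| ≤ C * Real.exp (-(c₁ * a β * n)) := by
  set T : ℕ := 2 ^ (M * J) with hT
  have hTpos : (0 : ℝ) < T := by positivity
  refine ⟨c / (T * ℓ), β₂, fun β => ⌈K⌉₊ * (T * N₀ β), by positivity, fun A B => ?_⟩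
  obtain ⟨C, hC⟩ := hcert A B
  refine ⟨max C 0, fun β hβ S n hS hn => ?_⟩
  obtain ⟨j, -, hjJ, hPj⟩ := exhaustion (u := fun j => amp β (2 ^ (M * j) * N₀ β))
    (P := fun j => Cert β (2 ^ (M * j) * N₀ β)) hδ (by simpa using hseed β hβ) (hbound β hβ)
    (hdich β hβ) hJ
  set b : ℕ := 2 ^ (M * j) * N₀ β with hb
  have hN₀1 : 1 ≤ N₀ β := hN₀pos β hβ
  have hb1 : 1 ≤ b := by
    have : 1 ≤ 2 ^ (M * j) := Nat.one_le_two_pow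
    calc 1 = 1 * 1 := by ring
      _ ≤ 2 ^ (M * j) * N₀ β := Nat.mul_le_mul this hN₀1
  have hbT : b ≤ T * N₀ β := by
    have : 2 ^ (M * j) ≤ 2 ^ (M * J) := Nat.pow_le_pow_right (by norm_num) (Nat.mul_le_mul_left M hjJ)
    exact Nat.mul_le_mul_right (N₀ β) this
  have hKb : K * (b : ℝ) ≤ S := by
    have h1 : K * (b : ℝ) ≤ (⌈K⌉₊ : ℝ) * ((T * N₀ β : ℕ) : ℝ) := by
      rcases le_or_gt 0 K with hK | hK
      · exact mul_le_mul (Nat.le_ceil K) (by exact_mod_cast hbT) (by positivity) (by positivity)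
      · exact (mul_nonpos_of_nonpos_of_nonneg hK.le (by positivity)).trans (by positivity)
    have h2 : ((⌈K⌉₊ : ℝ) * ((T * N₀ β : ℕ) : ℝ)) = ((⌈K⌉₊ * (T * N₀ β) : ℕ) : ℝ) := by push_cast; ring
    rw [h2] at h1
    exact h1.trans (by exact_mod_cast hS)
  have hcorr := hC β hβ b hb1 hPj S n hKb hn
  refine hcorr.trans ?_
  have hbpos : (0 : ℝ) < b := by exact_mod_cast hb1
  have hba : (b : ℝ) * a β ≤ T * ℓ := by
    have h1 : (b : ℝ) * a β ≤ ((T * N₀ β : ℕ) : ℝ) * a β :=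
      mul_le_mul_of_nonneg_right (by exact_mod_cast hbT) (hpos β).le
    have h2 : ((T * N₀ β : ℕ) : ℝ) * a β = (T : ℝ) * ((N₀ β : ℝ) * a β) := by push_cast; ring
    rw [h2] at h1
    exact h1.trans (mul_le_mul_of_nonneg_left (hN₀ β hβ) hTpos.le)
  have key : c / (T * ℓ) * a β * n ≤ c * n / b := by
    rw [le_div_iff₀ hbpos]
    have e : c / (T * ℓ) * a β * n * b = c * n * ((b : ℝ) * a β) / (T * ℓ) := by ring
    rw [e, div_le_iff₀ (by positivity : (0 : ℝ) < T * ℓ)]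
    exact mul_le_mul_of_nonneg_left hba (by positivity)
  calc C * Real.exp (-(c * n / b)) ≤ max C 0 * Real.exp (-(c * n / b)) :=
        mul_le_mul_of_nonneg_right (le_max_left _ _) (Real.exp_pos _).le
    _ ≤ max C 0 * Real.exp (-(c / (T * ℓ) * a β * n)) :=
        mul_le_mul_of_nonneg_left (Real.exp_le_exp.2 (neg_le_neg key)) (le_max_right _ _)

end Generic

/-! ## §3 The crux BY NAME from the line's one open stub -/

/-- **`LatticeGapInUVUnitsC` from the three stubs of the line** — SEED (= the landed `stub_ratioSeed`, p122959), BOUND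
(= the landed `stub_ratioBound`, p122942) and the windowed DICHOTOMY (the line's one open stub `stub_ratioDichotomy`), each
taken as a hypothesis written out in full (so this file depends on no unbuilt module; the skeleton instantiates the first
two with the tree theorems): ladder `k_j(β) = 2^{Mj} ⌊ℓ₀/(16 a β)⌋` from the femto edge for `β` beyond
`max 0 β₀ β₂` and beyond the coupling where `a < ℓ₀/32`; window count `J` from `exists_window_count`, certificate pipeline = the landed
`stub_gapToClustering stub_spectralToolkit.2 stub_lightCone` at the certified cell `b ≤ 16 k` (a smaller cell only
improves the rate); `concl_of_ratchet` gives the rate `c₁ = ρ/(2^{MJ} ℓ₀)`. -/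
theorem latticeGapInUVUnitsC_of_ratchet : (∀ (G : Type) [Group G] [TopologicalSpace G] [IsTopologicalGroup G] [CompactSpace G] [MeasurableSpace G] [BorelSpace G] (r : LatticeRep G) (a Γ : ℝ → ℝ) (β₀ ℓ₀ c C : ℝ), Continuous a → 0 < ℓ₀ → 0 < c → (∀ β, 0 < a β) → Filter.Tendsto a Filter.atTop (nhds 0) → (∀ s : ℝ, 0 < s → s ≤ ℓ₀ → 0 < Γ s ∧ Γ s ≤ 1) → (∀ (L : ℕ) [NeZero L] (β : ℝ), β₀ ≤ β → (L : ℝ) * a β ≤ ℓ₀ → let P : (Fin 4 → ZMod L) → Fin 4 → Fin 4 → GaugeConfig 4 L G → ℝ := fun x i j U => (r.N : ℝ) - (r.ρ (plaquetteHolonomy U x i j)).trace.re; let E : (GaugeConfig 4 L G → ℝ) → ℝ := fun F => wilsonExpectation (d := 4) (L := L) r.ρ β F; let cov : (GaugeConfig 4 L G → ℝ) → (GaugeConfig 4 L G → ℝ) → ℝ := fun F F' => E (fun U => F U * F' U) - E F * E F'; let dist : (Fin 4 → ZMod L) → (Fin 4 → ZMod L) → ℝ := fun x y => Real.sqrt (∑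 k : Fin 4, (((x k - y k).valMinAbs : ℤ) : ℝ) ^ 2); (∀ n : ℕ, 1 ≤ n → 8 * n ≤ L → c * Γ ((n : ℝ) * a β) ≤ (n : ℝ) ^ 8 * cov (P 0 0 1) (P (Pi.single (2 : Fin 4) ((n : ℕ) : ZMod L)) 0 1) ∧ (n : ℝ) ^ 8 * cov (P 0 0 1) (P (Pi.single (2 : Fin 4) ((n : ℕ) : ZMod L)) 0 1) ≤ C * Γ ((n : ℝ) * a β)) ∧ (∀ (x y : Fin 4 → ZMod L) (i j i' j' : Fin 4), x ≠ y → i ≠ j → i' ≠ j' → |cov (P x i j) (P y i' j')| * dist x y ^ 8 ≤ C * Γ (dist x y * a β))) → ∃ vmin : ℝ, 0 < vmin ∧ ∀ β : ℝ, β₀ ≤ β → ∀ (k : ℕ) [NeZero (16 * k)], ℓ₀ ≤ 32 * ((k : ℝ) * a β) → 16 * ((k : ℝ) * a β) ≤ ℓ₀ → vmin ≤ (wilsonExpectation r.ρ β (fun U : GaugeConfig 4 (16 * k) G => ((r.N : ℝ) - (r.ρ (plaquetteHolonomy U 0 0 1)).trace.re) * ((r.N : ℝ) - (r.ρ (plaquetteHolonomy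 U (Pi.single (2 : Fin 4) (((2 * k) : ℕ) : ZMod (16 * k))) 0 1)).trace.re)) - wilsonExpectation r.ρ β (fun U : GaugeConfig 4 (16 * k) G => (r.N : ℝ) - (r.ρ (plaquetteHolonomy U 0 0 1)).trace.re) * wilsonExpectation r.ρ β (fun U : GaugeConfig 4 (16 * k) G => (r.N : ℝ) - (r.ρ (plaquetteHolonomy U (Pi.single (2 : Fin 4) (((2 * k) : ℕ) : ZMod (16 * k))) 0 1)).trace.re)) / (wilsonExpectation r.ρ β (fun U : GaugeConfig 4 (16 * k) G => ((r.N : ℝ) - (r.ρ (plaquetteHolonomy U 0 0 1)).trace.re) * ((r.N : ℝ) - (r.ρ (plaquetteHolonomy U (Pi.single (2 : Fin 4) ((k : ℕ) : ZMod (16 * k))) 0 1)).trace.re)) - wilsonExpectation r.ρ β (fun U : GaugeConfig 4 (16 * k) G => (r.N : ℝ) - (r.ρ (plaquetteHolonomy U 0 0 1)).trace.re) * wilsonExpectation r.ρ β (fun U : GaugeConfig 4 (16 * k) G => (r.N : ℝ) - (r.ρ (plaquetteHolonomy U (Pi.single (2 : Fin 4) ((k : ℕ) : ZMod (16 * k)))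 0 1)).trace.re))) → (∀ (G : Type) [Group G] [TopologicalSpace G] [IsTopologicalGroup G] [CompactSpace G] [MeasurableSpace G] [BorelSpace G] (r : LatticeRep G) (β : ℝ), 0 ≤ β → ∀ (k : ℕ) [NeZero (16 * k)], (wilsonExpectation r.ρ β (fun U : GaugeConfig 4 (16 * k) G => ((r.N : ℝ) - (r.ρ (plaquetteHolonomy U 0 0 1)).trace.re) * ((r.N : ℝ) - (r.ρ (plaquetteHolonomy U (Pi.single (2 : Fin 4) (((2 * k) : ℕ) : ZMod (16 * k))) 0 1)).trace.re)) - wilsonExpectation r.ρ β (fun U : GaugeConfig 4 (16 * k) G => (r.N : ℝ) - (r.ρ (plaquetteHolonomy U 0 0 1)).trace.re) * wilsonExpectation r.ρ β (fun U : GaugeConfig 4 (16 * k) G => (r.N : ℝ) - (r.ρ (plaquetteHolonomy U (Pi.single (2 : Fin 4) (((2 * k) : ℕ) : ZMod (16 * k))) 0 1)).trace.re)) / (wilsonExpectation r.ρ β (fun U : GaugeConfig 4 (16 * k) G => ((r.N : ℝ) - (r.ρ (plaquetteHolonomy U 0 0 1)).trace.re) * ((r.N : ℝ) - (r.ρ (plaquetteHolonomy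 U (Pi.single (2 : Fin 4) ((k : ℕ) : ZMod (16 * k))) 0 1)).trace.re)) - wilsonExpectation r.ρ β (fun U : GaugeConfig 4 (16 * k) G => (r.N : ℝ) - (r.ρ (plaquetteHolonomy U 0 0 1)).trace.re) * wilsonExpectation r.ρ β (fun U : GaugeConfig 4 (16 * k) G => (r.N : ℝ) - (r.ρ (plaquetteHolonomy U (Pi.single (2 : Fin 4) ((k : ℕ) : ZMod (16 * k))) 0 1)).trace.re)) ≤ 1) → (∀ (G : Type) [Group G] [TopologicalSpace G] [IsTopologicalGroup G] [CompactSpace G] [MeasurableSpace G] [BorelSpace G] (r : LatticeRep G) (a Γ : ℝ → ℝ) (β₀ ℓ₀ c C : ℝ), IsCompactSimpleLieGroup G → Continuous a → 0 < ℓ₀ → 0 < c → (∀ β, 0 < a β) → Filter.Tendsto a Filter.atTop (nhds 0) → (∀ s : ℝ, 0 < s → s ≤ ℓ₀ → 0 < Γ s ∧ Γ s ≤ 1) → (∀ (L : ℕ) [NeZero L] (β : ℝ), β₀ ≤ β → (L : ℝ) * a β ≤ ℓ₀ → let P : (Fin 4 → ZMod L) → Fin 4 → Fin 4 → GaugeConfig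 4 L G → ℝ := fun x i j U => (r.N : ℝ) - (r.ρ (plaquetteHolonomy U x i j)).trace.re; let E : (GaugeConfig 4 L G → ℝ) → ℝ := fun F => wilsonExpectation (d := 4) (L := L) r.ρ β F; let cov : (GaugeConfig 4 L G → ℝ) → (GaugeConfig 4 L G → ℝ) → ℝ := fun F F' => E (fun U => F U * F' U) - E F * E F'; let dist : (Fin 4 → ZMod L) → (Fin 4 → ZMod L) → ℝ := fun x y => Real.sqrt (∑ k : Fin 4, (((x k - y k).valMinAbs : ℤ) : ℝ) ^ 2); (∀ n : ℕ, 1 ≤ n → 8 * n ≤ L → c * Γ ((n : ℝ) * a β) ≤ (n : ℝ) ^ 8 * cov (P 0 0 1) (P (Pi.single (2 : Fin 4) ((n : ℕ) : ZMod L)) 0 1) ∧ (n : ℝ) ^ 8 * cov (P 0 0 1) (P (Pi.single (2 : Fin 4) ((n : ℕ) : ZMod L)) 0 1) ≤ C * Γ ((n : ℝ) * a β)) ∧ (∀ (x y : Fin 4 → ZMod L) (i j i' j' : Fin 4), x ≠ y → i ≠ j → i' ≠ j' → |cov (P x i j) (P y i' j')| * dist x y ^ 8 ≤ C * Γ (dist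 x y * a β))) → ∃ (δ γ K β₂ : ℝ) (M : ℕ), 0 < δ ∧ 0 < γ ∧ ∀ β : ℝ, β₂ ≤ β → ∀ (k : ℕ) [NeZero (16 * k)] [NeZero (16 * (2 ^ M * k))], ℓ₀ ≤ 32 * ((k : ℝ) * a β) → (1 + δ) * ((wilsonExpectation r.ρ β (fun U : GaugeConfig 4 (16 * k) G => ((r.N : ℝ) - (r.ρ (plaquetteHolonomy U 0 0 1)).trace.re) * ((r.N : ℝ) - (r.ρ (plaquetteHolonomy U (Pi.single (2 : Fin 4) (((2 * k) : ℕ) : ZMod (16 * k))) 0 1)).trace.re)) - wilsonExpectation r.ρ β (fun U : GaugeConfig 4 (16 * k) G => (r.N : ℝ) - (r.ρ (plaquetteHolonomy U 0 0 1)).trace.re) * wilsonExpectation r.ρ β (fun U : GaugeConfig 4 (16 * k) G => (r.N : ℝ) - (r.ρ (plaquetteHolonomy U (Pi.single (2 : Fin 4) (((2 * k) : ℕ) : ZMod (16 * k))) 0 1)).trace.re)) / (wilsonExpectation r.ρ β (fun U : GaugeConfig 4 (16 * k) G => ((r.N : ℝ) - (r.ρ (plaquetteHolonomy U 0 0 1)).trace.re)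 * ((r.N : ℝ) - (r.ρ (plaquetteHolonomy U (Pi.single (2 : Fin 4) ((k : ℕ) : ZMod (16 * k))) 0 1)).trace.re)) - wilsonExpectation r.ρ β (fun U : GaugeConfig 4 (16 * k) G => (r.N : ℝ) - (r.ρ (plaquetteHolonomy U 0 0 1)).trace.re) * wilsonExpectation r.ρ β (fun U : GaugeConfig 4 (16 * k) G => (r.N : ℝ) - (r.ρ (plaquetteHolonomy U (Pi.single (2 : Fin 4) ((k : ℕ) : ZMod (16 * k))) 0 1)).trace.re))) ≤ (wilsonExpectation r.ρ β (fun U : GaugeConfig 4 (16 * (2 ^ M * k)) G => ((r.N : ℝ) - (r.ρ (plaquetteHolonomy U 0 0 1)).trace.re) * ((r.N : ℝ) - (r.ρ (plaquetteHolonomy U (Pi.single (2 : Fin 4) (((2 * (2 ^ M * k)) : ℕ) : ZMod (16 * (2 ^ M * k)))) 0 1)).trace.re)) - wilsonExpectation r.ρ β (fun U : GaugeConfig 4 (16 * (2 ^ M * k)) G => (r.N : ℝ) - (r.ρ (plaquetteHolonomy U 0 0 1)).trace.re) * wilsonExpectation r.ρ β (fun U : GaugeConfig 4 (16 * (2 ^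 M * k)) G => (r.N : ℝ) - (r.ρ (plaquetteHolonomy U (Pi.single (2 : Fin 4) (((2 * (2 ^ M * k)) : ℕ) : ZMod (16 * (2 ^ M * k)))) 0 1)).trace.re)) / (wilsonExpectation r.ρ β (fun U : GaugeConfig 4 (16 * (2 ^ M * k)) G => ((r.N : ℝ) - (r.ρ (plaquetteHolonomy U 0 0 1)).trace.re) * ((r.N : ℝ) - (r.ρ (plaquetteHolonomy U (Pi.single (2 : Fin 4) (((2 ^ M * k) : ℕ) : ZMod (16 * (2 ^ M * k)))) 0 1)).trace.re)) - wilsonExpectation r.ρ β (fun U : GaugeConfig 4 (16 * (2 ^ M * k)) G => (r.N : ℝ) - (r.ρ (plaquetteHolonomy U 0 0 1)).trace.re) * wilsonExpectation r.ρ β (fun U : GaugeConfig 4 (16 * (2 ^ M * k)) G => (r.N : ℝ) - (r.ρ (plaquetteHolonomy U (Pi.single (2 : Fin 4) (((2 ^ M * k) : ℕ) : ZMod (16 * (2 ^ M * k)))) 0 1)).trace.re)) ∨ ∃ b : ℕ, 1 ≤ b ∧ b ≤ 16 * (2 ^ M * k) ∧ ∀ S : ℕ, K * (((16 * (2 ^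 M * k) : ℕ)) : ℝ) ≤ S → GlobalPoincare r.ρ β (2 * S + 1) b γ) → Summit.QuantumFields.YangMills.Theses.LangevinControlUV.LatticeGapInUVUnitsC := by
  intro hseedS hboundS hdichotomy G _ _ _ _ hG
  letI : MeasurableSpace G := borel G
  haveI : BorelSpace G := ⟨rfl⟩
  intro r a ha hP
  obtain ⟨Γ, β₀, ℓ₀, c, C, hℓ₀, hc, hpos, hlim, hΓ, hbox⟩ := hP
  obtain ⟨vmin, hvmin, hseed⟩ := hseedS G r a Γ β₀ ℓ₀ c C ha hℓ₀ hc hpos hlim hΓ hbox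
  have hbound := hboundS G r
  obtain ⟨δ, γ, K, β₂, M, hδ, hγ, hdich⟩ := hdichotomy G r a Γ β₀ ℓ₀ c C hG ha hℓ₀ hc hpos hlim hΓ hbox
  obtain ⟨ρ, hρ, hpipe⟩ :=
    Summit.QuantumFields.YangMills.Theorems.LatticeGapInUVUnits.KnabeBlockSampler.stub_gapToClustering
      Summit.QuantumFields.YangMills.Theorems.LatticeGapInUVUnits.KnabeBlockSampler.stub_spectralToolkit.2
      Summit.QuantumFields.YangMills.Theorems.LatticeGapInUVUnits.KnabeBlockSampler.stub_lightCone G r γ hγ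
  obtain ⟨J, hJ⟩ := exists_window_count 1 hvmin hδ
  -- the ratio as a total function of the separation (`0` at `k = 0`), and its bridge to the explicit form
  let v : ℝ → ℕ → ℝ := fun β k => if hk : k = 0 then 0 else
    haveI : NeZero (16 * k) := ⟨by omega⟩
    (wilsonExpectation r.ρ β (fun U : GaugeConfig 4 (16 * k) G => ((r.N : ℝ) - (r.ρ (plaquetteHolonomy U 0 0 1)).trace.re) * ((r.N : ℝ) - (r.ρ (plaquetteHolonomy U (Pi.single (2 : Fin 4) (((2 * k) : ℕ) : ZMod (16 * k))) 0 1)).trace.re)) - wilsonExpectation r.ρ β (fun U : GaugeConfig 4 (16 * k) G => (r.N : ℝ) - (r.ρ (plaquetteHolonomy U 0 0 1)).trace.re) * wilsonExpectation r.ρ β (fun U : GaugeConfig 4 (16 * k) G => (r.N : ℝ) - (r.ρ (plaquetteHolonomy U (Pi.single (2 : Fin 4) (((2 * k) : ℕ) : ZMod (16 * k))) 0 1)).trace.re)) / (wilsonExpectation r.ρ β (fun U : GaugeConfig 4 (16 * k) G => ((r.N : ℝ) - (r.ρ (plaquetteHolonomy U 0 0 1)).trace.re) * ((r.N : ℝ)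 - (r.ρ (plaquetteHolonomy U (Pi.single (2 : Fin 4) ((k : ℕ) : ZMod (16 * k))) 0 1)).trace.re)) - wilsonExpectation r.ρ β (fun U : GaugeConfig 4 (16 * k) G => (r.N : ℝ) - (r.ρ (plaquetteHolonomy U 0 0 1)).trace.re) * wilsonExpectation r.ρ β (fun U : GaugeConfig 4 (16 * k) G => (r.N : ℝ) - (r.ρ (plaquetteHolonomy U (Pi.single (2 : Fin 4) ((k : ℕ) : ZMod (16 * k))) 0 1)).trace.re))
  have hv : ∀ (β : ℝ) (k : ℕ) [NeZero (16 * k)], k ≠ 0 → v β k = (wilsonExpectation r.ρ β (fun U : GaugeConfig 4 (16 * k) G => ((r.N : ℝ) - (r.ρ (plaquetteHolonomy U 0 0 1)).trace.re) * ((r.N : ℝ) - (r.ρ (plaquetteHolonomy U (Pi.single (2 : Fin 4) (((2 * k) : ℕ) : ZMod (16 * k))) 0 1)).trace.re)) - wilsonExpectation r.ρ β (fun U : GaugeConfig 4 (16 * k) G => (r.N : ℝ) - (r.ρ (plaquetteHolonomy U 0 0 1)).trace.re) * wilsonExpectation r.ρ β (fun U : GaugeConfig 4 (16 * k) G => (r.N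 : ℝ) - (r.ρ (plaquetteHolonomy U (Pi.single (2 : Fin 4) (((2 * k) : ℕ) : ZMod (16 * k))) 0 1)).trace.re)) / (wilsonExpectation r.ρ β (fun U : GaugeConfig 4 (16 * k) G => ((r.N : ℝ) - (r.ρ (plaquetteHolonomy U 0 0 1)).trace.re) * ((r.N : ℝ) - (r.ρ (plaquetteHolonomy U (Pi.single (2 : Fin 4) ((k : ℕ) : ZMod (16 * k))) 0 1)).trace.re)) - wilsonExpectation r.ρ β (fun U : GaugeConfig 4 (16 * k) G => (r.N : ℝ) - (r.ρ (plaquetteHolonomy U 0 0 1)).trace.re) * wilsonExpectation r.ρ β (fun U : GaugeConfig 4 (16 * k) G => (r.N : ℝ) - (r.ρ (plaquetteHolonomy U (Pi.single (2 : Fin 4) ((k : ℕ) : ZMod (16 * k))) 0 1)).trace.re)) := by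
    intro β k _ hk
    simp only [v, dif_neg hk]
  -- couplings beyond which `a β < ℓ₀ / 32`
  have h32 : (0 : ℝ) < ℓ₀ / 32 := by positivity
  obtain ⟨β₃, hβ₃⟩ := Filter.eventually_atTop.1 (hlim (Iio_mem_nhds h32))
  set βs : ℝ := max (max 0 β₀) (max β₂ β₃) with hβs
  have h0_le : ∀ β, βs ≤ β → 0 ≤ β := fun β h => le_trans (le_max_left _ _ |>.trans' (le_max_left _ _)) h
  have hβ₀_le : ∀ β, βs ≤ β → β₀ ≤ β := fun β h => le_trans (le_max_left _ _ |>.trans' (le_max_right _ _)) h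
  have hβ₂_le : ∀ β, βs ≤ β → β₂ ≤ β := fun β h => le_trans (le_max_right _ _ |>.trans' (le_max_left _ _)) h
  have hβ₃_le : ∀ β, βs ≤ β → β₃ ≤ β := fun β h => le_trans (le_max_right _ _ |>.trans' (le_max_right _ _)) h
  -- the femto-edge scale `k₀ β = ⌊ℓ₀ / (16 a β)⌋`
  set k₀ : ℝ → ℕ := fun β => ⌊ℓ₀ / (16 * a β)⌋₊ with hk₀
  have ha32 : ∀ β, βs ≤ β → a β < ℓ₀ / 32 := fun β h => hβ₃ β (hβ₃_le β h)
  have hk₀le : ∀ β, βs ≤ β → 16 * ((k₀ β : ℝ) * a β) ≤ ℓ₀ := by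
    intro β hβ
    have h1 : (k₀ β : ℝ) ≤ ℓ₀ / (16 * a β) :=
      Nat.floor_le (div_pos hℓ₀ (mul_pos (by norm_num) (hpos β))).le
    have h2 : (k₀ β : ℝ) * a β ≤ ℓ₀ / (16 * a β) * a β := mul_le_mul_of_nonneg_right h1 (hpos β).le
    have h3 : ℓ₀ / (16 * a β) * a β = ℓ₀ / 16 := by
      have hne := (hpos β).ne'
      field_simp
    linarith
  have hk₀ge : ∀ β, βs ≤ β → ℓ₀ ≤ 32 * ((k₀ β : ℝ) * a β) := by
    intro β hβ
    have h1 : ℓ₀ / (16 * a β) < (k₀ β : ℝ) + 1 := Nat.lt_floor_add_one _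
    have h2 : ℓ₀ / (16 * a β) * a β < ((k₀ β : ℝ) + 1) * a β := mul_lt_mul_of_pos_right h1 (hpos β)
    have h3 : ℓ₀ / (16 * a β) * a β = ℓ₀ / 16 := by
      have hne := (hpos β).ne'
      field_simp
    have h4 := ha32 β hβ
    nlinarith
  have hk₀pos : ∀ β, βs ≤ β → 1 ≤ k₀ β := by
    intro β hβ
    by_contra h0
    have h0' : k₀ β = 0 := by omega
    have := hk₀ge β hβ
    rw [h0'] at this
    simp at this
    linarith
  -- ladder arithmetic
  have hpow : ∀ (β : ℝ) (j : ℕ), 2 ^ M * (2 ^ (M * j) * k₀ β) = 2 ^ (M * (j + 1)) * k₀ β := by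
    intro β j; rw [Nat.mul_succ, pow_add]; ring
  have hladder_ne : ∀ β, βs ≤ β → ∀ j : ℕ, 2 ^ (M * j) * k₀ β ≠ 0 := fun β hβ j =>
    (Nat.mul_pos (pow_pos (by norm_num) _) (hk₀pos β hβ)).ne'
  have hladder_edge : ∀ β, βs ≤ β → ∀ j : ℕ, ℓ₀ ≤ 32 * (((2 ^ (M * j) * k₀ β : ℕ) : ℝ) * a β) := by
    intro β hβ j
    have h1 := hk₀ge β hβ
    have h2 : (k₀ β : ℝ) ≤ ((2 ^ (M * j) * k₀ β : ℕ) : ℝ) := by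
      exact_mod_cast Nat.le_mul_of_pos_left (k₀ β) (pow_pos (by norm_num) _)
    have h3 := mul_le_mul_of_nonneg_right h2 (hpos β).le
    linarith
  -- the generic ratchet, fed with the three stubs and the landed pipeline (certificate at cell `16 n`)
  refine concl_of_ratchet r hpos v
    (fun β n => ∃ b : ℕ, 1 ≤ b ∧ b ≤ 16 * n ∧
      ∀ S : ℕ, K * (((16 * n : ℕ)) : ℝ) ≤ S → GlobalPoincare r.ρ β (2 * S + 1) b γ)
    (ℓ := ℓ₀ / 16) (β₂ := βs) (umin := vmin) (U := 1) (K := 16 * max K 0) (c := ρ / 16)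
    hδ.le (by positivity) (by positivity) k₀ hk₀pos ?_ M J hJ ?_ ?_ ?_ ?_
  · -- femto edge: `k₀ β · a β ≤ ℓ₀ / 16`
    intro β hβ
    have := hk₀le β hβ
    linarith
  · -- SEED (S1)
    intro β hβ
    haveI : NeZero (16 * k₀ β) := ⟨by have := hk₀pos β hβ; omega⟩
    rw [hv β (k₀ β) (by have := hk₀pos β hβ; omega)]
    exact hseed β (hβ₀_le β hβ) (k₀ β) (hk₀ge β hβ) (hk₀le β hβ)
  · -- BOUND (S2)
    intro β hβ j _
    have hne := hladder_ne β hβ j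
    haveI : NeZero (16 * (2 ^ (M * j) * k₀ β)) := ⟨by omega⟩
    rw [hv β _ hne]
    exact hbound β (h0_le β hβ) _
  · -- DICHOTOMY (S4)
    intro β hβ j _
    have hne := hladder_ne β hβ j
    have hne' : 2 ^ M * (2 ^ (M * j) * k₀ β) ≠ 0 :=
      (Nat.mul_pos (pow_pos (by norm_num) _) (Nat.pos_of_ne_zero hne)).ne'
    haveI : NeZero (16 * (2 ^ (M * j) * k₀ β)) := ⟨by omega⟩
    haveI : NeZero (16 * (2 ^ M * (2 ^ (M * j) * k₀ β))) := ⟨by omega⟩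
    rw [← hpow β j]
    rcases hdich β (hβ₂_le β hβ) (2 ^ (M * j) * k₀ β) (hladder_edge β hβ j) with hgrow | hcert
    · left
      rw [hv β _ hne, hv β _ hne']
      exact hgrow
    · right
      exact hcert
  · -- PIPELINE (landed `stub_gapToClustering`, at the certified cell `b ≤ 16 n`)
    intro A B
    obtain ⟨C', hC'⟩ := hpipe A B
    refine ⟨max C' 0, fun β _ n hn hCert S n' hKS hn' => ?_⟩
    obtain ⟨b, hb1, hb16, hGP⟩ := hCert
    have hKS' : K * (((16 * n : ℕ)) : ℝ) ≤ S := by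
      have h1 : K * (((16 * n : ℕ)) : ℝ) ≤ max K 0 * (((16 * n : ℕ)) : ℝ) :=
        mul_le_mul_of_nonneg_right (le_max_left _ _) (by positivity)
      have h2 : max K 0 * (((16 * n : ℕ)) : ℝ) = 16 * max K 0 * (n : ℝ) := by push_cast; ring
      linarith
    have h := hC' β b S n' hb1 hn' (hGP S hKS')
    -- a smaller cell only improves the rate: `ρ n'/b ≥ (ρ/16) n'/n` since `b ≤ 16 n`
    have hbpos : (0 : ℝ) < b := by exact_mod_cast hb1
    have hnpos : (0 : ℝ) < n := by exact_mod_cast hn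
    have key : ρ / 16 * (n' : ℝ) / (n : ℝ) ≤ ρ * (n' : ℝ) / (b : ℝ) := by
      rw [div_le_div_iff₀ hnpos hbpos]
      have hb16' : (b : ℝ) ≤ 16 * (n : ℝ) := by exact_mod_cast hb16
      have hn'0 : (0 : ℝ) ≤ n' := Nat.cast_nonneg n'
      nlinarith [mul_le_mul_of_nonneg_left hb16' (mul_nonneg hρ.le hn'0)]
    calc |latticeConnectedCorr r.ρ β (2 * S + 1) A.F B.F n'| ≤ C' * Real.exp (-(ρ * n' / b)) := h
      _ ≤ max C' 0 * Real.exp (-(ρ * n' / b)) :=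
          mul_le_mul_of_nonneg_right (le_max_left _ _) (Real.exp_pos _).le
      _ ≤ max C' 0 * Real.exp (-(ρ / 16 * n' / n)) :=
          mul_le_mul_of_nonneg_left (Real.exp_le_exp.2 (neg_le_neg key)) (le_max_right _ _)

/-! ## §4 The open stub from ONE global block-sampler certificate (the knabe line's promoted stub, global form) -/

/-- **The windowed dichotomy from ONE global block-sampler certificate at cell `⌈K₀/a β⌉`.**  If for `β ≥ β₂` the
overlapping block heat bath at the physical cell `K₀` satisfies the global Poincaré inequality with constant `γ` on
all tori `S ≥ K ⌈K₀/a β⌉`, then the dichotomy holds with the certificate branch in EVERY window: choose `M` with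
`2^M ℓ₀ > 4 K₀`, so that the end torus `16·2^M k` of every window at or beyond the femto edge already exceeds the
certified cell (`⌈K₀/a β⌉ a β < 2K₀ ≤ 2^{M-1} ℓ₀ ≤ 16·2^M k a β` once `a β < K₀`). -/
theorem ratioDichotomy_of_globalCertificate : (∀ (G : Type) [Group G] [TopologicalSpace G] [IsTopologicalGroup G] [CompactSpace G] [MeasurableSpace G] [BorelSpace G] (r : LatticeRep G) (a Γ : ℝ → ℝ) (β₀ ℓ₀ c C : ℝ), IsCompactSimpleLieGroup G → Continuous a → 0 < ℓ₀ → 0 < c → (∀ β, 0 < a β) → Filter.Tendsto a Filter.atTop (nhds 0) → (∀ s : ℝ, 0 < s → s ≤ ℓ₀ → 0 < Γ s ∧ Γ s ≤ 1) → (∀ (L : ℕ) [NeZero L] (β : ℝ), β₀ ≤ β → (L : ℝ) * a β ≤ ℓ₀ → let P : (Fin 4 → ZMod L) → Fin 4 → Fin 4 → GaugeConfig 4 L G → ℝ := fun x i j U => (r.N : ℝ) - (r.ρ (plaquetteHolonomy U x i j)).trace.re; let E : (GaugeConfig 4 L G → ℝ) → ℝ := fun F => wilsonExpectation (d := 4)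 (L := L) r.ρ β F; let cov : (GaugeConfig 4 L G → ℝ) → (GaugeConfig 4 L G → ℝ) → ℝ := fun F F' => E (fun U => F U * F' U) - E F * E F'; let dist : (Fin 4 → ZMod L) → (Fin 4 → ZMod L) → ℝ := fun x y => Real.sqrt (∑ k : Fin 4, (((x k - y k).valMinAbs : ℤ) : ℝ) ^ 2); (∀ n : ℕ, 1 ≤ n → 8 * n ≤ L → c * Γ ((n : ℝ) * a β) ≤ (n : ℝ) ^ 8 * cov (P 0 0 1) (P (Pi.single (2 : Fin 4) ((n : ℕ) : ZMod L)) 0 1) ∧ (n : ℝ) ^ 8 * cov (P 0 0 1) (P (Pi.single (2 : Fin 4) ((n : ℕ) : ZMod L)) 0 1) ≤ C * Γ ((n : ℝ) * a β)) ∧ (∀ (x y : Fin 4 → ZMod L) (i j i' j' : Fin 4), x ≠ y → i ≠ j → i' ≠ j' → |cov (P x i j) (P y i' j')| * dist x y ^ 8 ≤ C * Γ (dist x y * a β))) → ∃ (K₀ γ K β₂ : ℝ), 0 < K₀ ∧ 0 < γ ∧ ∀ β : ℝ, β₂ ≤ β → ∀ S : ℕ, K * (⌈K₀ / a β⌉₊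 : ℝ) ≤ S → GlobalPoincare r.ρ β (2 * S + 1) ⌈K₀ / a β⌉₊ γ) → ∀ (G : Type) [Group G] [TopologicalSpace G] [IsTopologicalGroup G] [CompactSpace G] [MeasurableSpace G] [BorelSpace G] (r : LatticeRep G) (a Γ : ℝ → ℝ) (β₀ ℓ₀ c C : ℝ), IsCompactSimpleLieGroup G → Continuous a → 0 < ℓ₀ → 0 < c → (∀ β, 0 < a β) → Filter.Tendsto a Filter.atTop (nhds 0) → (∀ s : ℝ, 0 < s → s ≤ ℓ₀ → 0 < Γ s ∧ Γ s ≤ 1) → (∀ (L : ℕ) [NeZero L] (β : ℝ), β₀ ≤ β → (L : ℝ) * a β ≤ ℓ₀ → let P : (Fin 4 → ZMod L) → Fin 4 → Fin 4 → GaugeConfig 4 L G → ℝ := fun x i j U => (r.N : ℝ) - (r.ρ (plaquetteHolonomy U x i j)).trace.re; let E : (GaugeConfig 4 L G → ℝ) → ℝ := fun F => wilsonExpectation (d := 4) (L := L) r.ρ β F; let cov : (GaugeConfig 4 L G → ℝ) → (GaugeConfig 4 L G → ℝ) → ℝ := fun F F' => E (fun U => F U * F' U) - E F * E F'; let dist :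 (Fin 4 → ZMod L) → (Fin 4 → ZMod L) → ℝ := fun x y => Real.sqrt (∑ k : Fin 4, (((x k - y k).valMinAbs : ℤ) : ℝ) ^ 2); (∀ n : ℕ, 1 ≤ n → 8 * n ≤ L → c * Γ ((n : ℝ) * a β) ≤ (n : ℝ) ^ 8 * cov (P 0 0 1) (P (Pi.single (2 : Fin 4) ((n : ℕ) : ZMod L)) 0 1) ∧ (n : ℝ) ^ 8 * cov (P 0 0 1) (P (Pi.single (2 : Fin 4) ((n : ℕ) : ZMod L)) 0 1) ≤ C * Γ ((n : ℝ) * a β)) ∧ (∀ (x y : Fin 4 → ZMod L) (i j i' j' : Fin 4), x ≠ y → i ≠ j → i' ≠ j' → |cov (P x i j) (P y i' j')| * dist x y ^ 8 ≤ C * Γ (dist x y * a β))) → ∃ (δ γ K β₂ : ℝ) (M : ℕ), 0 < δ ∧ 0 < γ ∧ ∀ β : ℝ, β₂ ≤ β → ∀ (k : ℕ) [NeZero (16 * k)] [NeZero (16 * (2 ^ M * k))], ℓ₀ ≤ 32 * ((k : ℝ) * a β) → (1 + δ) * ((wilsonExpectation r.ρ β (fun U : GaugeConfig 4 (16 * k)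 G => ((r.N : ℝ) - (r.ρ (plaquetteHolonomy U 0 0 1)).trace.re) * ((r.N : ℝ) - (r.ρ (plaquetteHolonomy U (Pi.single (2 : Fin 4) (((2 * k) : ℕ) : ZMod (16 * k))) 0 1)).trace.re)) - wilsonExpectation r.ρ β (fun U : GaugeConfig 4 (16 * k) G => (r.N : ℝ) - (r.ρ (plaquetteHolonomy U 0 0 1)).trace.re) * wilsonExpectation r.ρ β (fun U : GaugeConfig 4 (16 * k) G => (r.N : ℝ) - (r.ρ (plaquetteHolonomy U (Pi.single (2 : Fin 4) (((2 * k) : ℕ) : ZMod (16 * k))) 0 1)).trace.re)) / (wilsonExpectation r.ρ β (fun U : GaugeConfig 4 (16 * k) G => ((r.N : ℝ) - (r.ρ (plaquetteHolonomy U 0 0 1)).trace.re) * ((r.N : ℝ) - (r.ρ (plaquetteHolonomy U (Pi.single (2 : Fin 4) ((k : ℕ) : ZMod (16 * k))) 0 1)).trace.re)) - wilsonExpectation r.ρ β (fun U : GaugeConfig 4 (16 * k) G => (r.N : ℝ) - (r.ρ (plaquetteHolonomy U 0 0 1)).trace.re) * wilsonExpectation r.ρ β (fun U : GaugeConfig 4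 (16 * k) G => (r.N : ℝ) - (r.ρ (plaquetteHolonomy U (Pi.single (2 : Fin 4) ((k : ℕ) : ZMod (16 * k))) 0 1)).trace.re))) ≤ (wilsonExpectation r.ρ β (fun U : GaugeConfig 4 (16 * (2 ^ M * k)) G => ((r.N : ℝ) - (r.ρ (plaquetteHolonomy U 0 0 1)).trace.re) * ((r.N : ℝ) - (r.ρ (plaquetteHolonomy U (Pi.single (2 : Fin 4) (((2 * (2 ^ M * k)) : ℕ) : ZMod (16 * (2 ^ M * k)))) 0 1)).trace.re)) - wilsonExpectation r.ρ β (fun U : GaugeConfig 4 (16 * (2 ^ M * k)) G => (r.N : ℝ) - (r.ρ (plaquetteHolonomy U 0 0 1)).trace.re) * wilsonExpectation r.ρ β (fun U : GaugeConfig 4 (16 * (2 ^ M * k)) G => (r.N : ℝ) - (r.ρ (plaquetteHolonomy U (Pi.single (2 : Fin 4) (((2 * (2 ^ M * k)) : ℕ) : ZMod (16 * (2 ^ M * k)))) 0 1)).trace.re)) / (wilsonExpectation r.ρ β (fun U : GaugeConfig 4 (16 * (2 ^ M * k)) G => ((r.N : ℝ) - (r.ρ (plaquetteHolonomy U 0 0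 1)).trace.re) * ((r.N : ℝ) - (r.ρ (plaquetteHolonomy U (Pi.single (2 : Fin 4) (((2 ^ M * k) : ℕ) : ZMod (16 * (2 ^ M * k)))) 0 1)).trace.re)) - wilsonExpectation r.ρ β (fun U : GaugeConfig 4 (16 * (2 ^ M * k)) G => (r.N : ℝ) - (r.ρ (plaquetteHolonomy U 0 0 1)).trace.re) * wilsonExpectation r.ρ β (fun U : GaugeConfig 4 (16 * (2 ^ M * k)) G => (r.N : ℝ) - (r.ρ (plaquetteHolonomy U (Pi.single (2 : Fin 4) (((2 ^ M * k) : ℕ) : ZMod (16 * (2 ^ M * k)))) 0 1)).trace.re)) ∨ ∃ b : ℕ, 1 ≤ b ∧ b ≤ 16 * (2 ^ M * k) ∧ ∀ S : ℕ, K * (((16 * (2 ^ M * k) : ℕ)) : ℝ) ≤ S → GlobalPoincare r.ρ β (2 * S + 1) b γ := by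
  intro hcert G _ _ _ _ _ _ r a Γ β₀ ℓ₀ c C hG ha hℓ₀ hc hpos hlim hΓ hbox
  obtain ⟨K₀, γ, K, β₂, hK₀, hγ, hGP⟩ := hcert G r a Γ β₀ ℓ₀ c C hG ha hℓ₀ hc hpos hlim hΓ hbox
  -- the window length: `2^M ℓ₀ ≥ 4 K₀`
  obtain ⟨M, hM⟩ := pow_unbounded_of_one_lt (4 * K₀ / ℓ₀) (by norm_num : (1 : ℝ) < 2)
  -- couplings beyond which `a β ≤ K₀` (so that `⌈K₀/a β⌉ ≤ 2 K₀ / a β`)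
  obtain ⟨β₃, hβ₃⟩ := Filter.eventually_atTop.1 (hlim (Iio_mem_nhds hK₀))
  refine ⟨1, γ, max K 0, max β₂ β₃, M, one_pos, hγ, fun β hβ k _ _ hk => Or.inr ?_⟩
  have hβ₂ : β₂ ≤ β := (le_max_left _ _).trans hβ
  have haK : a β < K₀ := hβ₃ β ((le_max_right _ _).trans hβ)
  have hKa : 0 < K₀ / a β := div_pos hK₀ (hpos β)
  refine ⟨⌈K₀ / a β⌉₊, Nat.one_le_iff_ne_zero.2 (Nat.ceil_pos.2 hKa).ne', ?_, fun S hS => hGP β hβ₂ S ?_⟩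
  · -- `⌈K₀/a β⌉ ≤ 16 · 2^M · k` because `2 K₀ ≤ 2^{M-1} ℓ₀ ≤ 16 · 2^M · k · a β`
    have h1 : ((⌈K₀ / a β⌉₊ : ℕ) : ℝ) < K₀ / a β + 1 := Nat.ceil_lt_add_one hKa.le
    have h2 : (K₀ / a β + 1) * a β = K₀ + a β := by
      rw [add_mul, one_mul, div_mul_cancel₀ K₀ (hpos β).ne']
    have h3 : ((⌈K₀ / a β⌉₊ : ℕ) : ℝ) * a β < 2 * K₀ := by
      have := mul_lt_mul_of_pos_right h1 (hpos β)
      linarith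
    have hM' : 4 * K₀ < 2 ^ M * ℓ₀ := by rwa [div_lt_iff₀ hℓ₀] at hM
    have h4 : 2 ^ M * ℓ₀ ≤ 32 * (2 ^ M * ((k : ℝ) * a β)) := by
      have := mul_le_mul_of_nonneg_left hk (by positivity : (0 : ℝ) ≤ 2 ^ M)
      linarith
    have h5 : ((⌈K₀ / a β⌉₊ : ℕ) : ℝ) * a β < ((16 * (2 ^ M * k) : ℕ) : ℝ) * a β := by
      push_cast
      nlinarith [hpos β]
    exact_mod_cast (lt_of_mul_lt_mul_right h5 (hpos β).le).le
  · -- torus condition: `K ⌈K₀/a β⌉ ≤ max K 0 · (16 · 2^M k) ≤ S`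
    have hb : ((⌈K₀ / a β⌉₊ : ℕ) : ℝ) ≤ ((16 * (2 ^ M * k) : ℕ) : ℝ) := by
      -- same comparison as above, non-strict
      have h1 : ((⌈K₀ / a β⌉₊ : ℕ) : ℝ) < K₀ / a β + 1 := Nat.ceil_lt_add_one hKa.le
      have h3 : ((⌈K₀ / a β⌉₊ : ℕ) : ℝ) * a β < 2 * K₀ := by
        have := mul_lt_mul_of_pos_right h1 (hpos β)
        have h2 : (K₀ / a β + 1) * a β = K₀ + a β := by
          rw [add_mul, one_mul, div_mul_cancel₀ K₀ (hpos β).ne']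
        linarith
      have hM' : 4 * K₀ < 2 ^ M * ℓ₀ := by rwa [div_lt_iff₀ hℓ₀] at hM
      have h4 : 2 ^ M * ℓ₀ ≤ 32 * (2 ^ M * ((k : ℝ) * a β)) := by
        have := mul_le_mul_of_nonneg_left hk (by positivity : (0 : ℝ) ≤ 2 ^ M)
        linarith
      have h5 : ((⌈K₀ / a β⌉₊ : ℕ) : ℝ) * a β ≤ ((16 * (2 ^ M * k) : ℕ) : ℝ) * a β := by
        push_cast
        nlinarith [hpos β]
      exact le_of_mul_le_mul_right h5 (hpos β)
    calc K * ((⌈K₀ / a β⌉₊ : ℕ) : ℝ) ≤ max K 0 * ((⌈K₀ / a β⌉₊ : ℕ) : ℝ) :=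
          mul_le_mul_of_nonneg_right (le_max_left _ _) (by positivity)
      _ ≤ max K 0 * (((16 * (2 ^ M * k) : ℕ)) : ℝ) := mul_le_mul_of_nonneg_left hb (le_max_right _ _)
      _ ≤ S := hS

/-- **The crux from SEED, BOUND and ONE global block-sampler certificate** (the knabe line's reduction
`cruxRepaired_of_blockSamplerCertificate` re-derived through the ratchet, in global form):
`latticeGapInUVUnitsC_of_ratchet` ∘ `ratioDichotomy_of_globalCertificate`. -/
theorem latticeGapInUVUnitsC_of_globalCertificate : (∀ (G : Type) [Group G] [TopologicalSpace G] [IsTopologicalGroup G] [CompactSpace G] [MeasurableSpace G] [BorelSpace G] (r : LatticeRep G) (a Γ : ℝ → ℝ) (β₀ ℓ₀ c C : ℝ), Continuous a → 0 < ℓ₀ → 0 < c → (∀ β, 0 < a β) → Filter.Tendsto a Filter.atTop (nhds 0) → (∀ s : ℝ, 0 < s → s ≤ ℓ₀ → 0 < Γ s ∧ Γ s ≤ 1) → (∀ (L : ℕ) [NeZero L] (β : ℝ), β₀ ≤ β → (L : ℝ) * a β ≤ ℓ₀ → let P : (Fin 4 → ZMod L) → Fin 4 → Fin 4 → GaugeConfig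 4 L G → ℝ := fun x i j U => (r.N : ℝ) - (r.ρ (plaquetteHolonomy U x i j)).trace.re; let E : (GaugeConfig 4 L G → ℝ) → ℝ := fun F => wilsonExpectation (d := 4) (L := L) r.ρ β F; let cov : (GaugeConfig 4 L G → ℝ) → (GaugeConfig 4 L G → ℝ) → ℝ := fun F F' => E (fun U => F U * F' U) - E F * E F'; let dist : (Fin 4 → ZMod L) → (Fin 4 → ZMod L) → ℝ := fun x y => Real.sqrt (∑ k : Fin 4, (((x k - y k).valMinAbs : ℤ) : ℝ) ^ 2); (∀ n : ℕ, 1 ≤ n → 8 * n ≤ L → c * Γ ((n : ℝ) * a β) ≤ (n : ℝ) ^ 8 * cov (P 0 0 1) (P (Pi.single (2 : Fin 4) ((n : ℕ) : ZMod L)) 0 1) ∧ (n : ℝ) ^ 8 * cov (P 0 0 1) (P (Pi.single (2 : Fin 4) ((n : ℕ) : ZMod L)) 0 1) ≤ C * Γ ((n : ℝ) * a β)) ∧ (∀ (x y : Fin 4 → ZMod L) (i j i' j' : Fin 4), x ≠ y → i ≠ j → i' ≠ j' → |cov (P x i j) (P y i' j')| * dist x y ^ 8 ≤ C * Γ (dist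 x y * a β))) → ∃ vmin : ℝ, 0 < vmin ∧ ∀ β : ℝ, β₀ ≤ β → ∀ (k : ℕ) [NeZero (16 * k)], ℓ₀ ≤ 32 * ((k : ℝ) * a β) → 16 * ((k : ℝ) * a β) ≤ ℓ₀ → vmin ≤ (wilsonExpectation r.ρ β (fun U : GaugeConfig 4 (16 * k) G => ((r.N : ℝ) - (r.ρ (plaquetteHolonomy U 0 0 1)).trace.re) * ((r.N : ℝ) - (r.ρ (plaquetteHolonomy U (Pi.single (2 : Fin 4) (((2 * k) : ℕ) : ZMod (16 * k))) 0 1)).trace.re)) - wilsonExpectation r.ρ β (fun U : GaugeConfig 4 (16 * k) G => (r.N : ℝ) - (r.ρ (plaquetteHolonomy U 0 0 1)).trace.re) * wilsonExpectation r.ρ β (fun U : GaugeConfig 4 (16 * k) G => (r.N : ℝ) - (r.ρ (plaquetteHolonomy U (Pi.single (2 : Fin 4) (((2 * k) : ℕ) : ZMod (16 * k))) 0 1)).trace.re)) / (wilsonExpectation r.ρ β (fun U : GaugeConfig 4 (16 * k) G => ((r.N : ℝ) - (r.ρ (plaquetteHolonomy U 0 0 1)).trace.re) * ((r.N : ℝ)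 - (r.ρ (plaquetteHolonomy U (Pi.single (2 : Fin 4) ((k : ℕ) : ZMod (16 * k))) 0 1)).trace.re)) - wilsonExpectation r.ρ β (fun U : GaugeConfig 4 (16 * k) G => (r.N : ℝ) - (r.ρ (plaquetteHolonomy U 0 0 1)).trace.re) * wilsonExpectation r.ρ β (fun U : GaugeConfig 4 (16 * k) G => (r.N : ℝ) - (r.ρ (plaquetteHolonomy U (Pi.single (2 : Fin 4) ((k : ℕ) : ZMod (16 * k))) 0 1)).trace.re))) → (∀ (G : Type) [Group G] [TopologicalSpace G] [IsTopologicalGroup G] [CompactSpace G] [MeasurableSpace G] [BorelSpace G] (r : LatticeRep G) (β : ℝ), 0 ≤ β → ∀ (k : ℕ) [NeZero (16 * k)], (wilsonExpectation r.ρ β (fun U : GaugeConfig 4 (16 * k) G => ((r.N : ℝ) - (r.ρ (plaquetteHolonomy U 0 0 1)).trace.re) * ((r.N : ℝ) - (r.ρ (plaquetteHolonomy U (Pi.single (2 : Fin 4) (((2 * k) : ℕ) : ZMod (16 * k))) 0 1)).trace.re)) - wilsonExpectation r.ρ β (fun U : GaugeConfig 4 (16 * k) G => (r.N : ℝ) -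 (r.ρ (plaquetteHolonomy U 0 0 1)).trace.re) * wilsonExpectation r.ρ β (fun U : GaugeConfig 4 (16 * k) G => (r.N : ℝ) - (r.ρ (plaquetteHolonomy U (Pi.single (2 : Fin 4) (((2 * k) : ℕ) : ZMod (16 * k))) 0 1)).trace.re)) / (wilsonExpectation r.ρ β (fun U : GaugeConfig 4 (16 * k) G => ((r.N : ℝ) - (r.ρ (plaquetteHolonomy U 0 0 1)).trace.re) * ((r.N : ℝ) - (r.ρ (plaquetteHolonomy U (Pi.single (2 : Fin 4) ((k : ℕ) : ZMod (16 * k))) 0 1)).trace.re)) - wilsonExpectation r.ρ β (fun U : GaugeConfig 4 (16 * k) G => (r.N : ℝ) - (r.ρ (plaquetteHolonomy U 0 0 1)).trace.re) * wilsonExpectation r.ρ β (fun U : GaugeConfig 4 (16 * k) G => (r.N : ℝ) - (r.ρ (plaquetteHolonomy U (Pi.single (2 : Fin 4) ((k : ℕ) : ZMod (16 * k))) 0 1)).trace.re)) ≤ 1) → (∀ (G : Type) [Group G] [TopologicalSpace G] [IsTopologicalGroup G] [CompactSpace G] [MeasurableSpace G] [BorelSpace G] (r : LatticeRep G) (a Γ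 : ℝ → ℝ) (β₀ ℓ₀ c C : ℝ), IsCompactSimpleLieGroup G → Continuous a → 0 < ℓ₀ → 0 < c → (∀ β, 0 < a β) → Filter.Tendsto a Filter.atTop (nhds 0) → (∀ s : ℝ, 0 < s → s ≤ ℓ₀ → 0 < Γ s ∧ Γ s ≤ 1) → (∀ (L : ℕ) [NeZero L] (β : ℝ), β₀ ≤ β → (L : ℝ) * a β ≤ ℓ₀ → let P : (Fin 4 → ZMod L) → Fin 4 → Fin 4 → GaugeConfig 4 L G → ℝ := fun x i j U => (r.N : ℝ) - (r.ρ (plaquetteHolonomy U x i j)).trace.re; let E : (GaugeConfig 4 L G → ℝ) → ℝ := fun F => wilsonExpectation (d := 4) (L := L) r.ρ β F; let cov : (GaugeConfig 4 L G → ℝ) → (GaugeConfig 4 L G → ℝ) → ℝ := fun F F' => E (fun U => F U * F' U) - E F * E F'; let dist : (Fin 4 → ZMod L) → (Fin 4 → ZMod L) → ℝ := fun x y => Real.sqrt (∑ k : Fin 4, (((x k - y k).valMinAbs : ℤ) : ℝ) ^ 2); (∀ n : ℕ, 1 ≤ n → 8 * n ≤ L → c * Γ ((n : ℝ) * a β)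 ≤ (n : ℝ) ^ 8 * cov (P 0 0 1) (P (Pi.single (2 : Fin 4) ((n : ℕ) : ZMod L)) 0 1) ∧ (n : ℝ) ^ 8 * cov (P 0 0 1) (P (Pi.single (2 : Fin 4) ((n : ℕ) : ZMod L)) 0 1) ≤ C * Γ ((n : ℝ) * a β)) ∧ (∀ (x y : Fin 4 → ZMod L) (i j i' j' : Fin 4), x ≠ y → i ≠ j → i' ≠ j' → |cov (P x i j) (P y i' j')| * dist x y ^ 8 ≤ C * Γ (dist x y * a β))) → ∃ (K₀ γ K β₂ : ℝ), 0 < K₀ ∧ 0 < γ ∧ ∀ β : ℝ, β₂ ≤ β → ∀ S : ℕ, K * (⌈K₀ / a β⌉₊ : ℝ) ≤ S → GlobalPoincare r.ρ β (2 * S + 1) ⌈K₀ / a β⌉₊ γ) → Summit.QuantumFields.YangMills.Theses.LangevinControlUV.LatticeGapInUVUnitsC :=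
  fun hseedS hboundS hcert => latticeGapInUVUnitsC_of_ratchet hseedS hboundS (ratioDichotomy_of_globalCertificate hcert)

end Summit.QuantumFields.YangMills.Theorems.LatticeGapInUVUnitsC.AmplitudeRatchet

end
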